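import Summits.CriticalPhenomena.PercolationContinuityZ3.Theorems.PercNearOneGluingNoHeavyPcintKernZ4S5Defs
import HarnessLib

/-!
# PCINT lane, kernel check 1/4 of the B2r window certificate `d = 4`, memory 5 (4-step windows, 4096 codes): codes `0 ≤ c < 1024`

Cell `prim-pcint`, seat `prim-pcint-2` (gen 2).  Collatz–Wielandt rows `10^5 · row ≤ 99999 · DEN · v` for the window codes in
`[0, 1024)`, by `decide +kernel` in chunks of `128` codes (natural-number arithmetic only; `maxHeartbeats 0`).
Does NOT build on p205010.
-/

namespace Summit.CriticalPhenomena.PercolationContinuityZ3.Theorems.Pcint.Z4S5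

set_option maxHeartbeats 0 in
/-- Rows `0 ≤ c < 128` of the certificate hold. [folklore] -/
theorem chk_0_128 : chk 0 128 = true := by decide +kernel

set_option maxHeartbeats 0 in
/-- Rows `128 ≤ c < 256` of the certificate hold. [folklore] -/
theorem chk_128_256 : chk 128 256 = true := by decide +kernel

set_option maxHeartbeats 0 in
/-- Rows `256 ≤ c < 384` of the certificate hold. [folklore] -/
theorem chk_256_384 : chk 256 384 = true := by decide +kernel

set_option maxHeartbeats 0 in
/-- Rows `384 ≤ c < 512` of the certificate hold. [folklore] -/
theorem chk_384_512 : chk 384 512 = true := by decide +kernel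

set_option maxHeartbeats 0 in
/-- Rows `512 ≤ c < 640` of the certificate hold. [folklore] -/
theorem chk_512_640 : chk 512 640 = true := by decide +kernel

set_option maxHeartbeats 0 in
/-- Rows `640 ≤ c < 768` of the certificate hold. [folklore] -/
theorem chk_640_768 : chk 640 768 = true := by decide +kernel

set_option maxHeartbeats 0 in
/-- Rows `768 ≤ c < 896` of the certificate hold. [folklore] -/
theorem chk_768_896 : chk 768 896 = true := by decide +kernel

set_option maxHeartbeats 0 in
/-- Rows `896 ≤ c < 1024` of the certificate hold. [folklore] -/
theorem chk_896_1024 : chk 896 1024 = true := by decide +kernel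

/-- Rows `0 ≤ c < 1024` of the certificate hold. [folklore] -/
theorem chkFile_1 : chk 0 1024 = true :=
  chk_split (chk_split (chk_split (chk_split (chk_split (chk_split (chk_split chk_0_128 chk_128_256) chk_256_384) chk_384_512) chk_512_640) chk_640_768) chk_768_896) chk_896_1024

end Summit.CriticalPhenomena.PercolationContinuityZ3.Theorems.Pcint.Z4S5
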